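import Mathlib
import Literature.Analysis.FluidPDE.TypeIAncientMild
import Literature.Analysis.FluidPDE.Vorticity
import Summits.NavierStokesRegularity.NavierStokesRegularity.Theorems.SymmetryModuliCountHelicalEndLiouvilleLineLiouvilleEnd
import Summits.NavierStokesRegularity.NavierStokesRegularity.Theorems.SymmetryModuliCountSymmetricLiouvilleSmallAtMinusInfinity
import Summits.NavierStokesRegularity.NavierStokesRegularity.Theorems.ClockStretchingLawClockCeilingStubTranslationInvariantAfter
import Summits.NavierStokesRegularity.NavierStokesRegularity.Theorems.ClockStretchingLawClockCeilingStubSliceInvariantOfCurlParallel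
import HarnessLib

/-!
# Route ClockStretchingLaw, crux `ClockCeiling` (stmt-NavierStokesRegularity-10570) — the ancient core of
# Giga–Miura's continuous-alignment criterion: a Type-I ancient mild field with unidirectional vorticity
# slices is trivial

Line `registered`, lead c7, stub `stub_unidirectionalVorticityLiouville` (`--supports 10570`).

Giga–Miura (Commun. Math. Phys. 303 (2011), Thm 1.1) prove that a Type-I blow-up of a bounded mild
solution cannot occur if the vorticity direction `ξ = ω/|ω|` is uniformly continuous in space
("continuous alignment"). The heart of their blow-up argument (Giga–Gu–Hsu 2019, §2.4) is a
Liouville statement for the blow-up limit: an ancient bounded mild solution whose vorticity "points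
out just one fixed direction" is two-dimensional and therefore trivial by the planar Liouville
theorem of Koch–Nadirashvili–Seregin–Šverák. This file proves that statement for the tree's Type-I
ancient mild class `A_C = IsTypeIAncientMild C` (KNSS/Oseen gauge), in a form that needs the
direction only slice by slice:

* `unidirectionalVorticityLiouville` — if for every `t < 0` the vorticity `curl u(t, ·)` is
  everywhere parallel to one nonzero vector `e(t)` (allowed to depend on `t`), then `u ≡ 0`;
* `unidirectionalVorticityLiouville_end` — the same with the hypothesis only on a backward end
  `t < T ≤ 0` (time shift + forward uniqueness);
* `stub_unidirectionalVorticityLiouville` (registered form) and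
  `unidirectionalVorticityLiouville_class` (the hypotheses of `ClockCeiling` verbatim).

## Proof

No vorticity equation and no time derivative of `e(t)` is used.
1. Slice lemma (`stub_sliceInvariantOfCurlParallel`, p167542): a bounded `C²` divergence-free field
   on `ℝ³` with `curl v ∥ e` everywhere is invariant under all translations along `ℝe`
   (`div curl = 0` makes `⟪curl v, e⟫` constant along `e`; the increment `v(· + he) − v` is bounded,
   divergence free and irrotational, hence constant, hence zero).
2. Forward propagation (`stub_translationInvariantAfter`, p167497): translation invariance of one
   slice of `u ∈ A_C` propagates to all later slices (translation covariance of the Oseen identity and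
   uniqueness of bounded Oseen-mild solutions). Hence the subspaces
   `W(t) = {b ∈ ℝ³ | u(t, · + h b) = u(t, ·) ∀ h}` are nested, `W(s) ≤ W(t)` for `s < t < 0`, and
   nonzero by step 1.
3. `exists_end_submodule_const`: a nested family of subspaces of `ℝ³` over `t < 0` is constant on a
   far-past end `t < t₁` (integer dimension argument). So `u` is invariant along the FIXED line
   `ℝ e(t₁)` for all `t < t₁`, and the landed 2.5-D leaf `stub_lineLiouvilleEnd` (rotation covariance
   of `A_C` + KNSS 2009 Thm 5.1 / Remark 6.1) gives `u ≡ 0` before `t₁`; forward uniqueness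
   (`vanishes_of_vanishes_before`) finishes.

Consumers: `ClockStretchingLawClockCeilingContinuousAlignmentRegular.lean` (Giga–Miura's Thm 1.1
for the route class: a singular Type-I model has no `t`-uniform spatial modulus of continuity of
`ξ`; `ClockCeiling` holds along continuously aligned elements).

## References

* Y. Giga, H. Miura, *On vorticity directions near singularities for the Navier–Stokes flows with
  infinite energy*, Commun. Math. Phys. 303 (2011) 289–300, Thm 1.1. [GigaMiura2011]
* Y. Giga, Z. Gu, P.-Y. Hsu, *Continuous alignment of vorticity direction prevents the blow-up of
  the Navier–Stokes flow under the no-slip boundary condition*, Nonlinear Anal. 189 (2019) 111579,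
  Thm 1.1 and §2.4 (held: paper:doi-10-1016-j-na-2019-111579, pp. 3, 7). [GigaGuHsu2019]
* G. Koch, N. Nadirashvili, G. Seregin, V. Šverák, Acta Math. 203 (2009) 83–105, Thm 5.1,
  Remark 6.1, §1 (symmetries) (arXiv:0709.3599). [KochNadirashviliSereginSverak2009]
-/

noncomputable section

-- the summit and its single sub-problem share the name (CONVENTIONS §1), as in every Theorems file
set_option linter.dupNamespace false

open Set Function Filter Topology Metric Module
open scoped RealInnerProductSpace

namespace Summit.NavierStokesRegularity.NavierStokesRegularity.Theorems

open Literature.Analysis Literature.Analysis.FluidPDE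
open Summit.NavierStokesRegularity.NavierStokesRegularity.Theorems.SymmetryModuliCountSymmetricLiouville

/-! ### Nested families of subspaces of `ℝ³` indexed by negative times stabilise in the far past -/

/-- **Stabilisation of a nested family of subspaces.** If `W : ℝ → Submodule ℝ ℝ³` is
non-decreasing along negative times (`W s ≤ W t` for `s < t < 0`), then on some far-past end
`t < t₁ < 0` it is constant: `W t = W t₁`. (The dimension `finrank (W t) ∈ {0,…,3}` is a
non-decreasing integer function of `t`; at a time `t₁` where it attains its minimum over `t < 0`
every earlier subspace is contained in `W t₁` with the same dimension.) [folklore] -/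
theorem exists_end_submodule_const (W : ℝ → Submodule ℝ (EuclideanSpace ℝ (Fin 3)))
    (hmono : ∀ s t : ℝ, s < t → t < 0 → W s ≤ W t) :
    ∃ t₁ < (0 : ℝ), ∀ t < t₁, W t = W t₁ := by
  classical
  have hP : ∃ n : ℕ, ∃ t < (0 : ℝ), finrank ℝ (W t) = n := ⟨_, -1, by norm_num, rfl⟩
  obtain ⟨t₁, ht₁, hd⟩ := Nat.find_spec hP
  refine ⟨t₁, ht₁, fun t ht => ?_⟩
  have hle : W t ≤ W t₁ := hmono t t₁ ht ht₁
  refine Submodule.eq_of_le_of_finrank_eq hle (le_antisymm (Submodule.finrank_mono hle) ?_)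
  rw [hd]
  exact Nat.find_min' hP ⟨t, ht.trans ht₁, rfl⟩

/-! ### The Liouville theorem -/

/-- **A Type-I ancient mild field whose vorticity is unidirectional on every slice vanishes** — the
ancient-solution core of Giga–Miura's criterion "continuous alignment of the vorticity direction
prevents Type-I blow-up" (Giga–Miura 2011, Thm 1.1; Giga–Gu–Hsu 2019, §2.4: in the blow-up limit
"ω points out just one fixed direction … the limit flow is two-dimensional … apply the Liouville
theorem to get `u ≡ 0`"). Let `u ∈ A_C` (`IsTypeIAncientMild C u`) and suppose that for every `t < 0`
there is a vector `e(t) ≠ 0` with `curl u(t,x) ∥ e(t)` for all `x`. Then `u ≡ 0` on `t < 0`.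

Proof. (1) Slice-wise, `u(t, ·)` is invariant under all translations along `ℝ e(t)`
(`stub_sliceInvariantOfCurlParallel`: `div curl = 0` makes `⟪ω, e⟫` constant along `e`, so
`u(t, · + h e) − u(t, ·)` is bounded, divergence free and irrotational, hence constant, hence `0`).
(2) The lines of invariance `W(t) = {b | u(t, · + h b) = u(t, ·) ∀ h}` form a subspace of `ℝ³`,
non-decreasing in `t` by forward uniqueness of bounded Oseen-mild solutions
(`stub_translationInvariantAfter`), and nonzero by (1). (3) By `exists_end_submodule_const` the family
is constant on a far-past end `t < t₁`, so `u` is invariant along the fixed line `ℝ e(t₁)` for all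
`t < t₁`; the 2.5-D leaf `stub_lineLiouvilleEnd` (rotation covariance + KNSS 2009 Thm 5.1 /
Remark 6.1, the planar Type-I Liouville theorem) gives `u ≡ 0` before `t₁`, and forward uniqueness
(`vanishes_of_vanishes_before`) on all of `t < 0`. No use is made of the vorticity equation.
(Giga–Gu–Hsu 2019 §2.4 [GigaGuHsu2019]; KNSS 2009 Thm 5.1, Remark 6.1 [KochNadirashviliSereginSverak2009].) [cite: GigaMiura2011, Thm 1.1 (Commun. Math. Phys. 303 (2011) 289–300)] -/
theorem unidirectionalVorticityLiouville {C : ℝ}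
    {u : ℝ → EuclideanSpace ℝ (Fin 3) → EuclideanSpace ℝ (Fin 3)} (hu : IsTypeIAncientMild C u)
    (hdir : ∀ t < 0, ∃ e : EuclideanSpace ℝ (Fin 3), e ≠ 0 ∧
      ∀ x, ∃ a : ℝ, curl (u t) x = a • e) :
    ∀ t < 0, ∀ x, u t x = 0 := by
  -- (1) slice-wise invariance along the vorticity direction
  have hslice : ∀ t < 0, ∃ e : EuclideanSpace ℝ (Fin 3), e ≠ 0 ∧
      ∀ (h : ℝ) (x : EuclideanSpace ℝ (Fin 3)), u t (x + h • e) = u t x := by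
    intro t ht
    obtain ⟨e, he, hpar⟩ := hdir t ht
    refine ⟨e, he, fun h x => ?_⟩
    exact stub_sliceInvariantOfCurlParallel (u t) ((hu.contDiff_slice ht).of_le two_le_infty)
      (hu.isDivFree ht) ⟨C / Real.sqrt (-t), fun x => hu.norm_le ht x⟩ e he hpar x h
  -- (2) the subspaces of invariance lines, nested forward in time
  let W : ℝ → Submodule ℝ (EuclideanSpace ℝ (Fin 3)) := fun t =>
    { carrier := {b | ∀ (h : ℝ) (x : EuclideanSpace ℝ (Fin 3)), u t (x + h • b) = u t x}
      add_mem' := fun {a b} ha hb h x => by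
        rw [smul_add, ← add_assoc, hb h (x + h • a), ha h x]
      zero_mem' := fun h x => by rw [smul_zero, add_zero]
      smul_mem' := fun c b hb h x => by rw [smul_smul]; exact hb (h * c) x }
  have hmemW : ∀ (t : ℝ) (b : EuclideanSpace ℝ (Fin 3)),
      b ∈ W t ↔ ∀ (h : ℝ) (x : EuclideanSpace ℝ (Fin 3)), u t (x + h • b) = u t x :=
    fun _ _ => Iff.rfl
  have hmono : ∀ s t : ℝ, s < t → t < 0 → W s ≤ W t := by
    intro s t hst ht b hb
    rw [hmemW] at hb ⊢
    intro h x
    exact stub_translationInvariantAfter C u hu s (h • b) (hst.trans ht) (fun y => hb h y) t hst ht x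
  -- (3) stabilisation on a far-past end and the 2.5-D leaf
  obtain ⟨t₁, ht₁, hconst⟩ := exists_end_submodule_const W hmono
  obtain ⟨e, he, heW⟩ := hslice t₁ ht₁
  have heW₁ : e ∈ W t₁ := (hmemW t₁ e).2 heW
  have hinv : ∀ t < t₁, ∀ (x : EuclideanSpace ℝ (Fin 3)) (s : ℝ), u t (x + s • e) = u t x := by
    intro t ht x s
    have hmem : e ∈ W t := by rw [hconst t ht]; exact heW₁
    exact (hmemW t e).1 hmem s x
  have hbefore : ∀ t < t₁, ∀ x, u t x = 0 := stub_lineLiouvilleEnd C u hu e t₁ he ht₁.le hinv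
  exact vanishes_of_vanishes_before hu ht₁ hbefore

/-- **End version**: it suffices that the vorticity be unidirectional on the slices of a BACKWARD END
`t < T ≤ 0` — shift time by `−T` (`IsTypeIAncientMild.comp_sub_right`, the class is invariant under
translations into the past), apply `unidirectionalVorticityLiouville` to the shifted field, and
propagate the vanishing forward (`vanishes_of_vanishes_before`). This is the form produced by
Giga–Miura's blow-up limit. [cite: GigaMiura2011, Thm 1.1] -/
theorem unidirectionalVorticityLiouville_end {C T : ℝ}
    {u : ℝ → EuclideanSpace ℝ (Fin 3) → EuclideanSpace ℝ (Fin 3)} (hu : IsTypeIAncientMild C u)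
    (hT : T ≤ 0)
    (hdir : ∀ t < T, ∃ e : EuclideanSpace ℝ (Fin 3), e ≠ 0 ∧
      ∀ x, ∃ a : ℝ, curl (u t) x = a • e) :
    ∀ t < 0, ∀ x, u t x = 0 := by
  -- the shifted field `v t = u (t - (-T)) = u (t + T)` lies in the class
  have hv : IsTypeIAncientMild C (fun t => u (t - (-T))) := hu.comp_sub_right (neg_nonneg.2 hT)
  have hv0 : ∀ t < 0, ∀ x, (fun t => u (t - (-T))) t x = 0 :=
    unidirectionalVorticityLiouville hv fun t ht => hdir (t - (-T)) (by linarith)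
  -- hence `u` vanishes before `T - 1 < 0`, and then everywhere by forward uniqueness
  have hbefore : ∀ t < T - 1, ∀ x, u t x = 0 := by
    intro t ht x
    have key := hv0 (t + (-T)) (by linarith) x
    simp only [add_sub_cancel_right] at key
    exact key
  exact vanishes_of_vanishes_before hu (by linarith) hbefore

/-- **Stub `stub_unidirectionalVorticityLiouville` (crux stmt-NavierStokesRegularity-10570, line
`registered`)**: registered form of `unidirectionalVorticityLiouville` — an element of the Type-I
ancient mild class whose vorticity is, on every slice, everywhere parallel to one (slice-dependent)
nonzero vector is identically zero. [cite: GigaMiura2011, Thm 1.1] -/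
theorem stub_unidirectionalVorticityLiouville :
    ∀ (C : ℝ) (u : ℝ → EuclideanSpace ℝ (Fin 3) → EuclideanSpace ℝ (Fin 3)), Literature.Analysis.FluidPDE.IsTypeIAncientMild C u → (∀ t < 0, ∃ e : EuclideanSpace ℝ (Fin 3), e ≠ 0 ∧ ∀ x, ∃ a : ℝ, Literature.Analysis.FluidPDE.curl (u t) x = a • e) → ∀ t < 0, ∀ x, u t x = 0 :=
  fun _ _ hu hdir => unidirectionalVorticityLiouville hu hdir

/-- **The same in the vocabulary of the route's class `𝒦_C`** (the hypotheses of `ClockCeiling`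
verbatim; the first four clauses are `IsTypeIAncientMild C u`, the energy ledger is not used): an
element of `𝒦_C` with unidirectional vorticity slices vanishes. [cite: GigaMiura2011, Thm 1.1] -/
theorem unidirectionalVorticityLiouville_class :
    ∀ (C : ℝ) (u : ℝ → EuclideanSpace ℝ (Fin 3) → EuclideanSpace ℝ (Fin 3)), (ContDiffOn ℝ (⊤ : ℕ∞) (Function.uncurry u) (Set.Iio 0 ×ˢ Set.univ) ∧ (∀ t < 0, Literature.Analysis.FluidPDE.VectorCalculus.IsDivFree (u t)) ∧ (∀ s t : ℝ, s < t → t < 0 → ∀ x, u t x = Literature.Analysis.FluidPDE.heatFlow (u s) (t - s) x - ∫ τ in Set.Ioo s t, ∫ y, ((-(inner ℝ (x - y) (u τ y) / (2 * (t - τ)) * Literature.Analysis.UnboundedOperators.heatKernel (t - τ) (x - y))) • u τ y + (∫ σ in Set.Ioi (t - τ), Literature.Analysis.UnboundedOperators.heatKernel σ (x - y) / (4 * σ ^ 2)) • (inner ℝ (x - y) (u τ y) • u τ y + inner ℝ (u τ y) (u τ y) • (x - y) + inner ℝ (x - y) (u τ y) • u τ y) - ((∫ σ in Set.Ioi (t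 - τ), Literature.Analysis.UnboundedOperators.heatKernel σ (x - y) / (8 * σ ^ 3)) * (inner ℝ (x - y) (u τ y) * inner ℝ (x - y) (u τ y))) • (x - y))) ∧ Literature.Analysis.FluidPDE.HasTypeITimeDecay C u ∧ (∀ (x₀ : EuclideanSpace ℝ (Fin 3)) (t₀ r : ℝ), t₀ ≤ 0 → 0 < r → (∀ t, t₀ - r ^ 2 < t → t < t₀ → r⁻¹ * ∫ x in Metric.ball x₀ r, ‖u t x‖ ^ 2 ≤ C) ∧ r⁻¹ * ∫ t in Set.Ioo (t₀ - r ^ 2) t₀, ∫ x in Metric.ball x₀ r, ‖fderiv ℝ (u t) x‖ ^ 2 ≤ C)) →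
      (∀ t < 0, ∃ e : EuclideanSpace ℝ (Fin 3), e ≠ 0 ∧ ∀ x, ∃ a : ℝ, Literature.Analysis.FluidPDE.curl (u t) x = a • e) →
      ∀ t < 0, ∀ x, u t x = 0 := by
  intro C u hu hdir
  have hTI : IsTypeIAncientMild C u :=
    isTypeIAncientMild_iff.2 ⟨hu.1, hu.2.1, hu.2.2.1, hu.2.2.2.1⟩
  exact unidirectionalVorticityLiouville hTI hdir

end Summit.NavierStokesRegularity.NavierStokesRegularity.Theorems

end
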